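import Summits.KontsevichZagierPeriods.KontsevichZagierPeriods.Theorems.RootDecompQuadraticDescentPair18HomotopyAngP10

/-! # `RootDecompQuadraticDescentPair18HomotopyAngP11` — part 11/20 of the mechanical ≤400-line split of `Pair18HomotopyAng_v13_landing.lean` (sha256 01bf0af4c8d09f43…)
Source: decomp-kz lens-6 g9 `Pair18HomotopyAng.lean` v13 (HOME/decomp-kz-lens-6/g9/, sha256 bd7fcda1…; critic g5 19:35:56Z CLEARED «angle side of #18 PROVED»: hTh7_holds, hB17_holds, hAng4_holds with no hypotheses) — companion file #2 of Pair18Homotopy v14 (landed as …Pair18HomotopyP01–P31): the verbatim COPIED PRELUDE is dropped in favour of those landed declarations, the four homonyms with different bodies are renamed (Th7_eq', TriA, isSemialgebraic_TriA, volume_diag'), `#print axioms` pins removed.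
Split by census-1 g9 `gen/splitlean.py`: scopes re-opened with their `open`/`variable`/`set_option` context; mathematics and declaration order unchanged. -/

set_option linter.unusedSimpArgs false
noncomputable section
open _root_.Set MvPolynomial
namespace Summit.KontsevichZagierPeriods.RootDecompQuadraticDescent.Pair18Homotopy
open Literature.NumberTheory.Transcendental
open Literature.NumberTheory.Transcendental.KZ (RFun cube)
open Summit.KontsevichZagierPeriods.RootDecompQuadraticDescent.DarkPairs (rel_reflect_rep rel_double)
section Fold
open Literature.ModelTheory.ExponentialFields (IsSemialgebraic isSemialgebraic_setOf_eval_le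
  isSemialgebraic_setOf_eval_pos isSemialgebraic_setOf_eval_nonneg isSemialgebraic_setOf_eval_eq_zero)

open _root_.Set MvPolynomial in
open Literature.NumberTheory.Transcendental in
open Literature.NumberTheory.Transcendental.KZ (RFun cube) in
open Summit.KontsevichZagierPeriods.RootDecompQuadraticDescent.DarkPairs (rel_reflect_rep rel_double) in
/-- Auxiliary step `vec2_1` (§2b): vec2 1. [bookkeeping] -/
private theorem vec2_1 (a b : ℝ) : (![a, b] : Fin 2 → ℝ) 1 = b := rfl

open _root_.Set MvPolynomial in
open Literature.NumberTheory.Transcendental in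
open Literature.NumberTheory.Transcendental.KZ (RFun cube) in
open Summit.KontsevichZagierPeriods.RootDecompQuadraticDescent.DarkPairs (rel_reflect_rep rel_double) in
/-- Auxiliary step `vec2_0` (§2b): vec2 0. [bookkeeping] -/
private theorem vec2_0 (a b : ℝ) : (![a, b] : Fin 2 → ℝ) 0 = a := rfl

open _root_.Set MvPolynomial in
open Literature.NumberTheory.Transcendental in
open Literature.NumberTheory.Transcendental.KZ (RFun cube) in
open Summit.KontsevichZagierPeriods.RootDecompQuadraticDescent.DarkPairs (rel_reflect_rep rel_double) in
/-- Auxiliary step `cube2` (§0): cube2. [bookkeeping] -/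
private theorem cube2 {x : Fin 2 → ℝ} (hx : x ∈ KZ.cube 2) : (0 ≤ x 0 ∧ x 0 ≤ 1) ∧ (0 ≤ x 1 ∧ x 1 ≤ 1) := ⟨hx 0, hx 1⟩

/-- **hAng4 as lattice rectangles + three shear-cells (end of g9).**  Modulo KZ-relations,
`[AngH|RM] + [AngH|RK₊] + [AngH|RK₋] ≡ 2·[AngH|R₀] + [AngH|R₁] + [AngH|B] + [AngH|Trap'_lo] + [AngH|Trap'_hi]
 + [AngH|Ũ₋'] + [AngH|S'_lo]` with `R₀ = [α₁,θ−α₁]×[0,α₁]`, `R₁ = [α₁,θ−α₁]×[α₁,2α₁]`, `B = [α₁,θ−α₁]²`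
(areas `2α₁β + α₁β + β² + α₁²/2 + α₁² + α₁²/2 + α₁β = θ² − 2α₁²`). -/
theorem hAng4_lattice2 :
    KZ.of AngHM + KZ.of AngHp + KZ.of AngHm
      - 2 • KZ.of AngHFanLo - KZ.of AngHMrectHi - KZ.of AngHBsq - KZ.of AngHTrapLo - KZ.of AngHTrapHi
      - KZ.of AngHUmr - KZ.of AngHSLo ∈ KZ.relations := by
  have h := add_mem (add_mem hAng4_lattice AngHMrect_cut) AngHMrectLo_FanLo
  convert h using 1
  abel

/-- **hAng4 ⟸ hLat₂** — `2[R₀] + [R₁] + [B] + [Trap'_lo] + [Trap'_hi] + [Ũ₋'] + [S'_lo] ≡ [Th7] − 2[B17]`; since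
`[Th7] − 2[B17] ≡ 2[Sqα] + 3[R₀] + [R₁] + [B]` by the lattice dissection of `[0,θ]²` (NODE §9.23 X1–X2, in the `B17`
chart), `hLat₂` is: three rational shears (`Trap'_hi → Sqα`, `Ũ₋' → swap Trap'_lo`, `S'_lo → R₀`), one diagonal cut,
and the four `1/√7`-scalings `Sqα, R₀, R₁, B ↦` their `B17`-chart rectangles. -/
theorem hAng4_of_lattice2
    (hLat : 2 • KZ.of AngHFanLo + KZ.of AngHMrectHi + KZ.of AngHBsq + KZ.of AngHTrapLo + KZ.of AngHTrapHi
      + KZ.of AngHUmr + KZ.of AngHSLo - KZ.of Th7.rep + 2 • KZ.of B17.rep ∈ KZ.relations) :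
    KZ.of AngHM + KZ.of AngHp + KZ.of AngHm - KZ.of Th7.rep + 2 • KZ.of B17.rep ∈ KZ.relations := by
  have h := add_mem hAng4_lattice2 hLat
  convert h using 1
  abel

/-! ### §19n  The rational shear `Φm : (P,Q) ↦ (P, (P−Q)/(1+PQ))` (`v ↦ φ − v`) as a GENERIC move on
`AngH`-cells, and `[AngH | S'_lo] ≡ [AngH | R₀]`

`Φm` is an involution preserving the measure `AngH ds dw = dφ dψ`; for any two cells `S, T ⊆ [0,1]²` on which
`1 + PQ > 0`, `Φm(S) ⊆ T` and `Φm(T) ⊆ S` already give `[AngH|S] ≡ [AngH|T]` (`AngH_shear`).  Applied to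
`S'_lo = {α₁≤φ≤θ−α₁, φ−α₁≤v≤φ}` it yields the lattice rectangle `R₀ = [α₁,θ−α₁]×[0,α₁]`; the same lemma (composed
with the reflection `Q ↦ −Q`) handles `Trap'_hi ↦ [0,α₁]²` and `Ũ₋' ↦ swap Trap'_lo` in g10. -/

/-- the shear `(s,w) ↦ (s, w')` with `4w'−2 = (2s − (4w−2))/(1 + 2s(4w−2))`. -/
def Φm (z : Fin 2 → ℝ) : Fin 2 → ℝ :=
  ![z 0, (2 * (1 + 2 * z 0 * (4 * z 1 - 2)) + (2 * z 0 - (4 * z 1 - 2))) / (4 * (1 + 2 * z 0 * (4 * z 1 - 2)))]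

/-- Auxiliary step `Φm_zero` (§19n): Φm zero. [bookkeeping] -/
theorem Φm_zero (z : Fin 2 → ℝ) : Φm z 0 = z 0 := rfl
/-- Auxiliary step `Φm_one` (§19n): Φm one. [bookkeeping] -/
theorem Φm_one (z : Fin 2 → ℝ) :
    Φm z 1 = (2 * (1 + 2 * z 0 * (4 * z 1 - 2)) + (2 * z 0 - (4 * z 1 - 2))) / (4 * (1 + 2 * z 0 * (4 * z 1 - 2))) :=
  rfl
/-- `Q'·(1+PQ) = P − Q`. -/
theorem Φm_Q (z : Fin 2 → ℝ) (hD : 0 < 1 + 2 * z 0 * (4 * z 1 - 2)) :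
    (4 * Φm z 1 - 2) * (1 + 2 * z 0 * (4 * z 1 - 2)) = 2 * z 0 - (4 * z 1 - 2) := by
  rw [Φm_one]
  have hDne := hD.ne'
  field_simp
  ring
/-- `(1 + PQ')·(1+PQ) = 1 + P²`. -/
theorem Φm_D (z : Fin 2 → ℝ) (hD : 0 < 1 + 2 * z 0 * (4 * z 1 - 2)) :
    (1 + 2 * z 0 * (4 * Φm z 1 - 2)) * (1 + 2 * z 0 * (4 * z 1 - 2)) = 1 + 4 * z 0 * z 0 := by
  have h := Φm_Q z hD
  have : (1 + 2 * z 0 * (4 * Φm z 1 - 2)) * (1 + 2 * z 0 * (4 * z 1 - 2)) =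
      (1 + 2 * z 0 * (4 * z 1 - 2)) + 2 * z 0 * ((4 * Φm z 1 - 2) * (1 + 2 * z 0 * (4 * z 1 - 2))) := by ring
  rw [this, h]; ring
/-- Auxiliary step `Φm_D_pos` (§19n): Φm D pos. [bookkeeping] -/
theorem Φm_D_pos (z : Fin 2 → ℝ) (hD : 0 < 1 + 2 * z 0 * (4 * z 1 - 2)) :
    0 < 1 + 2 * z 0 * (4 * Φm z 1 - 2) := by
  have h := Φm_D z hD
  have h1 : (0:ℝ) < 1 + 4 * z 0 * z 0 := by nlinarith [mul_self_nonneg (z 0)]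
  by_contra hn
  have hn' := not_lt.mp hn
  have hm := mul_le_mul_of_nonneg_right hn' hD.le
  rw [h, zero_mul] at hm
  linarith
/-- `Φm` is an involution (`v ↦ φ − v` twice). -/
theorem Φm_invol (z : Fin 2 → ℝ) (hD : 0 < 1 + 2 * z 0 * (4 * z 1 - 2)) : Φm (Φm z) = z := by
  have hQ := Φm_Q z hD
  have hDD := Φm_D z hD
  have hD' := Φm_D_pos z hD
  have hQ2 := Φm_Q (Φm z) (by rw [Φm_zero]; exact hD')
  rw [Φm_zero] at hQ2
  -- `Q''·D' = P − Q'`; multiply by `D`: `Q''·(1+P²) = P·D − (P − Q) = Q(1+P²)`.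
  have h1 : (0:ℝ) < 1 + 4 * z 0 * z 0 := by nlinarith [mul_self_nonneg (z 0)]
  have key : (4 * Φm (Φm z) 1 - 2) * (1 + 4 * z 0 * z 0) = (4 * z 1 - 2) * (1 + 4 * z 0 * z 0) := by
    have e : (4 * Φm (Φm z) 1 - 2) * (1 + 4 * z 0 * z 0) =
        ((4 * Φm (Φm z) 1 - 2) * (1 + 2 * z 0 * (4 * Φm z 1 - 2))) * (1 + 2 * z 0 * (4 * z 1 - 2)) := by
      rw [← hDD]; ring
    rw [e, hQ2, sub_mul, hQ]; ring
  have k2 : 4 * Φm (Φm z) 1 - 2 = 4 * z 1 - 2 := mul_right_cancel₀ h1.ne' key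
  funext i
  fin_cases i
  · rfl
  · show Φm (Φm z) 1 = z 1
    linarith

set_option maxHeartbeats 1600000 in
/-- **The shear as a KZ-move.**  For cells `S, T ⊆ [0,1]²` with `1 + PQ > 0` on both and `Φm(S) ⊆ T`, `Φm(T) ⊆ S`:
`[AngH | S] ≡ [AngH | T]` (`|det DΦm| = (1+P²)/(1+PQ)²`, `(1+PQ)² + (P−Q)² = (1+P²)(1+Q²)`). -/
theorem AngH_shear {S T : Set (Fin 2 → ℝ)} (hS : IsSemialgebraic ℚ S) (hT : IsSemialgebraic ℚ T)
    (hSc : S ⊆ cube 2) (hTc : T ⊆ cube 2)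
    (hpos : ∀ z ∈ S, 0 < 1 + 2 * z 0 * (4 * z 1 - 2)) (hposT : ∀ w ∈ T, 0 < 1 + 2 * w 0 * (4 * w 1 - 2))
    (hST : ∀ z ∈ S, Φm z ∈ T) (hTS : ∀ w ∈ T, Φm w ∈ S) :
    KZ.of (AngH.rep.restrict S hS hSc) - KZ.of (AngH.rep.restrict T hT hTc) ∈ KZ.relations := by
  let M10 : (Fin 2 → ℝ) → ℝ := fun z =>
    (1 + (4 * z 1 - 2) * (4 * z 1 - 2)) / (2 * ((1 + 2 * z 0 * (4 * z 1 - 2)) * (1 + 2 * z 0 * (4 * z 1 - 2))))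
  let M11 : (Fin 2 → ℝ) → ℝ := fun z =>
    -(1 + 4 * z 0 * z 0) / ((1 + 2 * z 0 * (4 * z 1 - 2)) * (1 + 2 * z 0 * (4 * z 1 - 2)))
  let Mz : (Fin 2 → ℝ) → Matrix (Fin 2) (Fin 2) ℝ := fun z => !![1, 0; M10 z, M11 z]
  let Φ' : (Fin 2 → ℝ) → (Fin 2 → ℝ) →L[ℝ] (Fin 2 → ℝ) := fun z =>
    LinearMap.toContinuousLinearMap (Matrix.toLin' (Mz z))
  have hΦ'ap : ∀ z w, Φ' z w = ![w 0, M10 z * w 0 + M11 z * w 1] := by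
    intro z w; funext i
    fin_cases i <;> simp [Φ', Mz, Matrix.toLin'_apply, Matrix.mulVec, dotProduct, Fin.sum_univ_two]
  have hdet : ∀ z, (Φ' z).det = M11 z := by
    intro z
    unfold ContinuousLinearMap.det
    simp [Φ', LinearMap.det_toLin', Mz, Matrix.det_fin_two]
  have hdom : (AngH.rep.restrict T hT hTc).domain = Φm '' (AngH.rep.restrict S hS hSc).domain := by
    simp only [KZ.IntegralRep.domain_restrict]
    ext w
    constructor
    · intro hw
      exact ⟨Φm w, hTS w hw, Φm_invol w (hposT w hw)⟩
    · rintro ⟨z, hz, rfl⟩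
      exact hST z hz
  refine KZ.changeOfVariablesRel_subset_relations
    ⟨2, AngH.rep.restrict S hS hSc, AngH.rep.restrict T hT hTc, Φm, Φ', ?_, ?_, ?_, hdom, ?_, rfl⟩
  · have hsd : IsSemialgebraic ℚ (AngH.rep.restrict S hS hSc).domain :=
      (AngH.rep.restrict S hS hSc).isSemialgebraic_domain
    refine (isSemialgebraicMapOn_iff_forall_holds hsd).mpr fun i => ?_
    fin_cases i
    · exact (isSemialgebraicFunOn_aeval hsd (X 0)).congr fun z _ => by
        simp only [Φm, Fin.zero_eta, Matrix.cons_val_zero, aeval_X]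
    · refine (isSemialgebraicFunOn_aeval_div_aeval hsd
          (C 2 * (C 1 + C 2 * X 0 * (C 4 * X 1 - C 2)) + (C 2 * X 0 - (C 4 * X 1 - C 2)))
          (C 4 * (C 1 + C 2 * X 0 * (C 4 * X 1 - C 2))) fun z hz => ?_).congr fun z _ => ?_
      · have hz' : z ∈ S := by simpa [KZ.IntegralRep.domain_restrict] using hz
        have hD := hpos z hz'
        simp only [map_add, map_sub, map_mul, aeval_C, aeval_X, eq_ratCast, Rat.cast_ofNat, Rat.cast_one]
        linarith
      · simp only [Φm, Fin.mk_one, Matrix.cons_val_one, Matrix.head_cons, Matrix.cons_val_fin_one, map_add,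
          map_sub, map_mul, aeval_C, aeval_X, eq_ratCast, Rat.cast_ofNat, Rat.cast_one]
  · intro z hz
    have hz' : z ∈ S := by simpa [KZ.IntegralRep.domain_restrict] using hz
    have hDp := hpos z hz'
    have hDne : (1 + 2 * z 0 * (4 * z 1 - 2)) ≠ 0 := hDp.ne'
    have h4Dne : 4 * (1 + 2 * z 0 * (4 * z 1 - 2)) ≠ 0 := mul_ne_zero (by norm_num) hDne
    have hA := hasFDerivAt_apply (𝕜 := ℝ) 0 z
    have hB := hasFDerivAt_apply (𝕜 := ℝ) 1 z
    have hQ := (hB.const_mul (4:ℝ)).sub_const (2:ℝ)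
    have hDd := ((hA.const_mul (2:ℝ)).mul hQ).const_add (1:ℝ)
    have hNd := (hA.const_mul (2:ℝ)).sub hQ
    have hNum := (hDd.const_mul (2:ℝ)).add hNd
    have hDen := hDd.const_mul (4:ℝ)
    have hinv := (hasDerivAt_inv h4Dne).comp_hasFDerivAt z hDen
    have hcomp1 := hNum.mul hinv
    have hpi : HasFDerivAt Φm (Φ' z) z := by
      rw [hasFDerivAt_pi']
      intro i
      fin_cases i
      · refine (hA.congr_fderiv ?_).congr_of_eventuallyEq (Filter.Eventually.of_forall fun y => ?_)
        · ext w
          simp [hΦ'ap]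
        · simp only [Fin.zero_eta, Φm_zero]
      · refine (hcomp1.congr_fderiv ?_).congr_of_eventuallyEq (Filter.Eventually.of_forall fun y => ?_)
        · ext w
          simp [hΦ'ap, M10, M11]
          field_simp
          ring
        · simp only [Fin.mk_one, Φm_one, Function.comp_apply, Pi.mul_apply, Pi.add_apply, Pi.sub_apply,
            div_eq_mul_inv]
    exact hpi.hasFDerivWithinAt
  · intro z₁ hz₁ z₂ hz₂ heq
    have hz₁' : z₁ ∈ S := by simpa [KZ.IntegralRep.domain_restrict] using hz₁
    have hz₂' : z₂ ∈ S := by simpa [KZ.IntegralRep.domain_restrict] using hz₂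
    have h := congr_arg Φm heq
    rwa [Φm_invol z₁ (hpos z₁ hz₁'), Φm_invol z₂ (hpos z₂ hz₂')] at h
  · intro z hz
    have hz' : z ∈ S := by simpa [KZ.IntegralRep.domain_restrict] using hz
    have hDp := hpos z hz'
    have hDne : (1 + 2 * z 0 * (4 * z 1 - 2)) ≠ 0 := hDp.ne'
    have h1pos : (0:ℝ) < 1 + 4 * z 0 * z 0 := by nlinarith [mul_self_nonneg (z 0)]
    have hneg : M11 z < 0 := by
      simp only [M11]
      rw [neg_div]
      exact neg_neg_of_pos (div_pos h1pos (mul_pos hDp hDp))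
    rw [hdet z, abs_of_neg hneg]
    simp only [M11]
    simp only [KZ.IntegralRep.integrand_restrict, RFun.rep_integrand]
    simp only [AngH, AngDen, RFun.fn, Φm, map_add, map_sub, map_mul, aeval_C, aeval_X, eq_ratCast, Rat.cast_one,
      Rat.cast_ofNat, vec2_0, vec2_1, Matrix.cons_val_zero, Matrix.cons_val_one, Matrix.head_cons]
    have hQ' : 4 * ((2 * (1 + 2 * z 0 * (4 * z 1 - 2)) + (2 * z 0 - (4 * z 1 - 2))) /
          (4 * (1 + 2 * z 0 * (4 * z 1 - 2)))) - 2 =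
        (2 * z 0 - (4 * z 1 - 2)) / (1 + 2 * z 0 * (4 * z 1 - 2)) := by
      field_simp; ring
    rw [hQ']
    have h1ne : (1 + 4 * z 0 * z 0) ≠ 0 := h1pos.ne'
    have hQQ : (0:ℝ) < 1 + (4 * z 1 - 2) * (4 * z 1 - 2) := by nlinarith [mul_self_nonneg (4 * z 1 - 2)]
    have h2ne : (1 + (4 * z 1 - 2) * (4 * z 1 - 2)) ≠ 0 := hQQ.ne'
    generalize hDdef : 1 + 2 * z 0 * (4 * z 1 - 2) = D at *
    have h4ne : (1 + (2 * z 0 - (4 * z 1 - 2)) / D * ((2 * z 0 - (4 * z 1 - 2)) / D)) ≠ 0 :=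
      (by nlinarith [mul_self_nonneg ((2 * z 0 - (4 * z 1 - 2)) / D)] :
        (0:ℝ) < 1 + (2 * z 0 - (4 * z 1 - 2)) / D * ((2 * z 0 - (4 * z 1 - 2)) / D)).ne'
    field_simp
    rw [← hDdef]
    ring

/-- bounds of `Φm z 1` from bounds of `Q' = 4·Φm z 1 − 2`. -/
theorem Φm_one_mem (z : Fin 2 → ℝ) (h1 : 0 ≤ 4 * Φm z 1 - 2 + 2) (h2 : 4 * Φm z 1 - 2 ≤ 2) :
    0 ≤ Φm z 1 ∧ Φm z 1 ≤ 1 := by constructor <;> linarith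

/-- **`[AngH | S'_lo] ≡ [AngH | R₀]`** (`v ↦ φ − v`). -/
theorem AngHSLo_FanLo : KZ.of AngHSLo - KZ.of AngHFanLo ∈ KZ.relations := by
  refine AngH_shear isSemialgebraic_SLo (isSemialgebraic_Fan.inter isSemialgebraic_sQa) (fun _ hz => hz.1)
    (fun _ hz => hz.1.1) (fun z hz => ?_) (fun w hw => ?_) (fun z hz => ?_) (fun w hw => ?_)
  · obtain ⟨hc, ⟨⟨⟨⟨⟨r1, r2⟩, u1⟩, u2⟩, u3⟩, i3⟩⟩ := hz
    have h0 := (cube2 hc).1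
    simp only [sU1, mem_setOf_eq] at u1
    nlinarith [mul_nonneg h0.1 (by linarith : (0:ℝ) ≤ 4 * z 1 - 2)]
  · obtain ⟨⟨hc, ⟨⟨⟨r1, r2⟩, u1⟩, u2⟩⟩, qa⟩ := hw
    have h0 := (cube2 hc).1
    simp only [sU1, mem_setOf_eq] at u1
    nlinarith [mul_nonneg h0.1 (by linarith : (0:ℝ) ≤ 4 * w 1 - 2)]
  · -- `Φm(S'_lo) ⊆ R₀`
    obtain ⟨hc, ⟨⟨⟨⟨⟨r1, r2⟩, u1⟩, u2⟩, u3⟩, i3⟩⟩ := hz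
    have h0 := (cube2 hc).1
    simp only [sRM1, sRM2, sU1, sU2, sU3, mem_setOf_eq] at r1 r2 u1 u2 u3
    have hQ0 : (0:ℝ) ≤ 4 * z 1 - 2 := by linarith
    have hD : (0:ℝ) < 1 + 2 * z 0 * (4 * z 1 - 2) := by nlinarith [mul_nonneg h0.1 hQ0]
    have hq := Φm_Q z hD
    set q : ℝ := 4 * Φm z 1 - 2 with hq_def
    have hq0 : 0 ≤ q := by
      by_contra hn; have hn' := not_le.mp hn
      nlinarith [mul_neg_of_neg_of_pos hn' hD]
    have hqP : q ≤ 2 * z 0 := by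
      by_contra hn; have hn' := not_le.mp hn
      nlinarith [mul_lt_mul_of_pos_right hn' hD, mul_nonneg (mul_nonneg h0.1 h0.1) hQ0]
    have hsq : (q * (1 + 2 * z 0 * (4 * z 1 - 2))) * (q * (1 + 2 * z 0 * (4 * z 1 - 2))) =
        (2 * z 0 - (4 * z 1 - 2)) * (2 * z 0 - (4 * z 1 - 2)) := by rw [hq]
    have hqa : 7 * (q * q) ≤ 1 := by
      by_contra hn; have hn' := not_le.mp hn
      nlinarith [mul_lt_mul_of_pos_right hn' (mul_pos hD hD)]
    have hm := Φm_one_mem z (by linarith) (by linarith [h0.2])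
    refine ⟨⟨?_, ⟨⟨⟨?_, ?_⟩, ?_⟩, ?_⟩⟩, ?_⟩
    · intro i
      fin_cases i
      · simp only [Fin.zero_eta, Φm_zero]; exact h0
      · exact hm
    · simp only [sRM1, mem_setOf_eq, Φm_zero]; exact r1
    · simp only [sRM2, mem_setOf_eq, Φm_zero]; exact r2
    · simp only [sU1, mem_setOf_eq]; linarith
    · simp only [sU2, mem_setOf_eq, Φm_zero]; exact hqP
    · simp only [sQa, mem_setOf_eq]; exact hqa
  · -- `Φm(R₀) ⊆ S'_lo`
    obtain ⟨⟨hc, ⟨⟨⟨r1, r2⟩, u1⟩, u2⟩⟩, qa⟩ := hw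
    have h0 := (cube2 hc).1
    simp only [sRM1, sRM2, sU1, sU2, sQa, mem_setOf_eq] at r1 r2 u1 u2 qa
    have hQ0 : (0:ℝ) ≤ 4 * w 1 - 2 := by linarith
    have hD : (0:ℝ) < 1 + 2 * w 0 * (4 * w 1 - 2) := by nlinarith [mul_nonneg h0.1 hQ0]
    have h1 : (0:ℝ) < 1 + 4 * w 0 * w 0 := by nlinarith [mul_self_nonneg (w 0)]
    have hq := Φm_Q w hD
    have hdd := Φm_D w hD
    set q : ℝ := 4 * Φm w 1 - 2 with hq_def
    have hq0 : 0 ≤ q := by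
      by_contra hn; have hn' := not_le.mp hn
      nlinarith [mul_neg_of_neg_of_pos hn' hD]
    have hqP : q ≤ 2 * w 0 := by
      by_contra hn; have hn' := not_le.mp hn
      nlinarith [mul_lt_mul_of_pos_right hn' hD, mul_nonneg (mul_nonneg h0.1 h0.1) hQ0]
    -- `(P − q)·D = Q(1+P²)`, `(1 + Pq)·D = 1 + P²`
    have e1 : (2 * w 0 - q) * (1 + 2 * w 0 * (4 * w 1 - 2)) = (4 * w 1 - 2) * (1 + 4 * w 0 * w 0) := by
      rw [sub_mul, hq]; ring
    have e2 := hdd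
    have key : 7 * ((2 * w 0 - q) * (2 * w 0 - q)) ≤ (1 + 2 * w 0 * q) * (1 + 2 * w 0 * q) := by
      have k1 : 7 * (((2 * w 0 - q) * (1 + 2 * w 0 * (4 * w 1 - 2))) * ((2 * w 0 - q) * (1 + 2 * w 0 * (4 * w 1 - 2))))
          ≤ ((1 + 2 * w 0 * q) * (1 + 2 * w 0 * (4 * w 1 - 2))) * ((1 + 2 * w 0 * q) * (1 + 2 * w 0 * (4 * w 1 - 2))) := by
        rw [e1, e2]
        nlinarith [mul_pos h1 h1]
      by_contra hn; have hn' := not_le.mp hn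
      nlinarith [mul_lt_mul_of_pos_right hn' (mul_pos hD hD)]
    have hm := Φm_one_mem w (by linarith) (by linarith [h0.2])
    refine ⟨?_, ⟨⟨⟨⟨⟨?_, ?_⟩, ?_⟩, ?_⟩, ?_⟩, ?_⟩⟩
    · intro i
      fin_cases i
      · simp only [Fin.zero_eta, Φm_zero]; exact h0
      · exact hm
    · simp only [sRM1, mem_setOf_eq, Φm_zero]; exact r1
    · simp only [sRM2, mem_setOf_eq, Φm_zero]; exact r2
    · simp only [sU1, mem_setOf_eq]; linarith
    · simp only [sU2, mem_setOf_eq, Φm_zero]; exact hqP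
    · simp only [sU3, mem_setOf_eq, Φm_zero]; exact key
    · simp only [sI3, mem_setOf_eq]
      nlinarith [mul_le_mul hqP hqP hq0 (by linarith)]

/-- **hAng4 with `S'_lo` absorbed (end of g9).**  Modulo KZ-relations,
`[AngH|RM] + [AngH|RK₊] + [AngH|RK₋] ≡ 3·[AngH|R₀] + [AngH|R₁] + [AngH|B] + [AngH|Trap'_lo] + [AngH|Trap'_hi]
 + [AngH|Ũ₋']`. -/
theorem hAng4_lattice3 :
    KZ.of AngHM + KZ.of AngHp + KZ.of AngHm
      - 3 • KZ.of AngHFanLo - KZ.of AngHMrectHi - KZ.of AngHBsq - KZ.of AngHTrapLo - KZ.of AngHTrapHi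
      - KZ.of AngHUmr ∈ KZ.relations := by
  have h := add_mem hAng4_lattice2 AngHSLo_FanLo
  convert h using 1
  abel

end Fold
end Summit.KontsevichZagierPeriods.RootDecompQuadraticDescent.Pair18Homotopy
end
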